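import Summits.ResolutionOfSingularities.ResolutionOfSingularities.Theorems.WildPurityWildSymbolNoLU
import Literature.AlgebraicGeometry.Resolution.LocalUniformizationAbhyankarPlaces
import Literature.AlgebraicGeometry.Resolution.ResolutionOfCurves
import HarnessLib

/-!
# `WildSymbol` (stmt-ResolutionOfSingularities-17133), line `birth` — a witness place is NON-ABHYANKAR,
# and the function field has transcendence degree `≥ 2`, modulo Gros–Suwa 1988 ONLY

Support file for crux #2 of route `ResolutionOfSingularities/WildPurity`
(`Summit.ResolutionOfSingularities.ResolutionOfSingularities.Theses.WildPurity.WildSymbol`), line `birth`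
(lead c3, crux cycle 4). Companion of `Theorems/WildPurityWildSymbolNoLU.lean` (a witness sits at a valuation ring
WITHOUT relative local uniformization, modulo `GrosSuwa1988_purity`) and
`Theorems/WildPurityWildSymbolDimensionFour.lean` (trdeg `≥ 4`, modulo Gros–Suwa + Cossart–Piltant). Here the
relative local uniformization theorems the tree PROVES are fed in, so the calibrations below depend on the single
named fact `GrosSuwa1988_purity`:

* `relLU_at_abhyankarPlace_of_perfectField` (Knaf–Kuhlmann 2005, Thm. 1.1 with Cor. 2.2, PROVED in the tree from
  Kuhlmann's generalized stability theorem): over a perfect ground field every Abhyankar place admits relative local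
  uniformization. Hence **a witness valuation ring is NOT an Abhyankar place of `K | k`**
  (`not_isAbhyankarPlace_of_witness`, `not_wildSymbol_at_abhyankarPlace`): the route's informal calibration "tame /
  Abhyankar places absorb everything" is now a theorem modulo Gros–Suwa.
* `relLocalUniformization_of_trdeg_le_one` (PROVED in the tree: resolution of curves): hence **trdeg `K > 1`** for a
  witness, modulo Gros–Suwa only (`one_lt_trdeg_of_witness`, `not_wildSymbol_trdeg_le_one`) — the standing
  disprover's sorried near-miss `not_wildSymbol_of_trdeg_le_one` (Disproof.lean (e)), now closed modulo `GrosSuwa1988_purity`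
  and for arbitrary (not necessarily normal) models.
* `wildSymbol_iff_nonAbhyankar` — the crux may be read with the conjuncts "`O` is not an Abhyankar place" and
  "trdeg `> 1`" added for free (modulo Gros–Suwa).

No definition is declared; nothing here concludes the crux positively.
-/

noncomputable section

-- single-problem summit: the doubled namespace component `ResolutionOfSingularities` is forced
set_option linter.dupNamespace false

namespace Summit.ResolutionOfSingularities.ResolutionOfSingularities.Theorems.WildSymbol.Birth

open Summit.ResolutionOfSingularities.ResolutionOfSingularities.Theses.WildPurity (WildSymbol)
open Literature.AlgebraicGeometry.Resolution
open Literature.NumberTheory.GaloisCohomology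

variable {k K : Type} [Field k] [Field K] [Algebra k K]

/-- **A witness place is not an Abhyankar place** (modulo Gros–Suwa 1988): for `k` perfect, `K/k` finitely generated,
`O ⊇ k` a valuation ring of `K` that IS an Abhyankar place of `K | k` (equality in Abhyankar's inequality), every
candidate `α` with (D) for a model `R ⊆ O` is `O`-integral — by the PROVED relative local uniformization at Abhyankar
places over perfect fields (Knaf–Kuhlmann 2005) and the regular-point theorem. [cite: KnafKuhlmann2005, Thm. 1.1 and Cor. 2.2] -/
theorem mem_Unr_of_divIntegral_of_isAbhyankarPlace (hGS : GrosSuwa1988_purity.{0}) {p : ℕ} (hp : p.Prime)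
    [CharP k p] [PerfectField k] (hKfg : (⊤ : IntermediateField k K).FG) (O : ValuationSubring K)
    (hO : ∀ c : k, algebraMap k K c ∈ O) (hAbh : IsAbhyankarPlace O (algebraMap k K).fieldRange ⊤)
    (R : Subalgebra k K) (hRfg : R.FG) (hRO : R.toSubring ≤ O.toSubring)
    (α : G K ⧸ N p K) (hdiv : DivIntegral p k K R O α) : α ∈ Unr p K O.toSubring := by
  obtain ⟨A, hAO, hRA, hAfg, hAfr, hreg⟩ := relLU_at_abhyankarPlace_of_perfectField hKfg O hO hAbh R hRfg hRO
  exact mem_Unr_of_divIntegral_of_isRegularLocalRing hGS hp O A hAfg hAO hAfr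
    (isRegularLocalRing_locAt_of_atPrime A O hAO hreg) α (divIntegral_antitone p hRA O hdiv)

/-- **A witness valuation ring is NON-Abhyankar** (modulo Gros–Suwa 1988). [cite: KnafKuhlmann2005, Thm. 1.1 and Cor. 2.2] -/
theorem not_isAbhyankarPlace_of_witness (hGS : GrosSuwa1988_purity.{0}) {p : ℕ} (hp : p.Prime)
    [CharP k p] [PerfectField k] (hKfg : (⊤ : IntermediateField k K).FG) (O : ValuationSubring K)
    (hO : ∀ c : k, algebraMap k K c ∈ O) (R : Subalgebra k K) (hRfg : R.FG) (hRO : R.toSubring ≤ O.toSubring)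
    (α : G K ⧸ N p K) (hdiv : DivIntegral p k K R O α) (hα : α ∉ Unr p K O.toSubring) :
    ¬ IsAbhyankarPlace O (algebraMap k K).fieldRange ⊤ :=
  fun hAbh => hα (mem_Unr_of_divIntegral_of_isAbhyankarPlace hGS hp hKfg O hO hAbh R hRfg hRO α hdiv)

/-- **CALIBRATION (negative lemma): no witness at an Abhyankar place** (modulo Gros–Suwa 1988): the crux with the
extra conjunct "`O` is an Abhyankar place of `K | k`" is false. [cite: KnafKuhlmann2005, Thm. 1.1 and Cor. 2.2] -/
theorem not_wildSymbol_at_abhyankarPlace (hGS : GrosSuwa1988_purity.{0}) :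
    ¬ ∃ p : ℕ, p.Prime ∧ ∃ (k K : Type) (_ : Field k) (_ : CharP k p) (_ : PerfectField k) (_ : Field K)
      (_ : Algebra k K), (⊤ : IntermediateField k K).FG ∧ ∃ O : ValuationSubring K,
      (∀ c : k, algebraMap k K c ∈ O) ∧ IsAbhyankarPlace O (algebraMap k K).fieldRange ⊤ ∧
      ∃ R : Subalgebra k K, R.FG ∧ R.toSubring ≤ O.toSubring ∧ IsFractionRing R K ∧
      ∃ α : G K ⧸ N p K, DivIntegral p k K R O α ∧ α ∉ Unr p K O.toSubring := by
  rintro ⟨p, hp, k, K, _, _, _, _, _, hfg, O, hO, hAbh, R, hR, hRO, -, α, hdiv, hα⟩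
  exact not_isAbhyankarPlace_of_witness hGS hp hfg O hO R hR hRO α hdiv hα hAbh

/-- **trdeg `K > 1` for a witness, modulo Gros–Suwa 1988 only**: in transcendence degree `≤ 1` every valuation ring
has relative local uniformization (`relLocalUniformization_of_trdeg_le_one`, PROVED in the tree from resolution of
curves), which kills the candidate. [folklore] -/
theorem one_lt_trdeg_of_witness (hGS : GrosSuwa1988_purity.{0}) {p : ℕ} (hp : p.Prime) [CharP k p]
    [PerfectField k] (O : ValuationSubring K) (R : Subalgebra k K) (hRfg : R.FG)
    (hRO : R.toSubring ≤ O.toSubring) (hRfr : IsFractionRing R K)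
    (α : G K ⧸ N p K) (hdiv : DivIntegral p k K R O α) (hα : α ∉ Unr p K O.toSubring) :
    ¬ Algebra.trdeg k K ≤ 1 :=
  fun h1 => not_relLU_of_witness hGS hp O R hRfg hRO hRfr α hdiv hα
    (relLocalUniformization_of_trdeg_le_one k K h1 O)

/-- **CALIBRATION (negative lemma): no witness in transcendence degree `≤ 1`** (modulo Gros–Suwa 1988 only; the
standing disprover's near-miss `not_wildSymbol_of_trdeg_le_one`, for arbitrary affine models). [folklore] -/
theorem not_wildSymbol_trdeg_le_one (hGS : GrosSuwa1988_purity.{0}) :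
    ¬ ∃ p : ℕ, p.Prime ∧ ∃ (k K : Type) (_ : Field k) (_ : CharP k p) (_ : PerfectField k) (_ : Field K)
      (_ : Algebra k K), (⊤ : IntermediateField k K).FG ∧ Algebra.trdeg k K ≤ 1 ∧ ∃ O : ValuationSubring K,
      (∀ c : k, algebraMap k K c ∈ O) ∧ ∃ R : Subalgebra k K, R.FG ∧ R.toSubring ≤ O.toSubring ∧
      IsFractionRing R K ∧ ∃ α : G K ⧸ N p K, DivIntegral p k K R O α ∧ α ∉ Unr p K O.toSubring := by
  rintro ⟨p, hp, k, K, _, _, _, _, _, -, h1, O, -, R, hR, hRO, hfr, α, hdiv, hα⟩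
  exact one_lt_trdeg_of_witness hGS hp O R hR hRO hfr α hdiv hα h1

/-- **The crux carries "non-Abhyankar" and "trdeg `> 1`" for free** (modulo Gros–Suwa 1988): `WildSymbol` is
equivalent to its restatement with the conjuncts `¬ IsAbhyankarPlace O (im k) K` and `¬ Algebra.trdeg k K ≤ 1` added.
[cite: KnafKuhlmann2005, Thm. 1.1 and Cor. 2.2] -/
theorem wildSymbol_iff_nonAbhyankar (hGS : GrosSuwa1988_purity.{0}) :
    WildSymbol ↔ ∃ p : ℕ, p.Prime ∧ ∃ (k K : Type) (_ : Field k) (_ : CharP k p) (_ : PerfectField k)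
      (_ : Field K) (_ : Algebra k K), (⊤ : IntermediateField k K).FG ∧ ¬ Algebra.trdeg k K ≤ 1 ∧
      ∃ O : ValuationSubring K, (∀ c : k, algebraMap k K c ∈ O) ∧
      ¬ IsAbhyankarPlace O (algebraMap k K).fieldRange ⊤ ∧ ∃ R : Subalgebra k K, R.FG ∧
      R.toSubring ≤ O.toSubring ∧ IsFractionRing R K ∧
      ∃ α : G K ⧸ N p K, DivIntegral p k K R O α ∧ α ∉ Unr p K O.toSubring := by
  rw [wildSymbol_iff]
  constructor
  · rintro ⟨p, hp, k, K, ik, icp, ipf, iK, ialg, hfg, O, hO, R, hR, hRO, hfr, α, hdiv, hα⟩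
    exact ⟨p, hp, k, K, ik, icp, ipf, iK, ialg, hfg, one_lt_trdeg_of_witness hGS hp O R hR hRO hfr α hdiv hα,
      O, hO, not_isAbhyankarPlace_of_witness hGS hp hfg O hO R hR hRO α hdiv hα, R, hR, hRO, hfr, α, hdiv, hα⟩
  · rintro ⟨p, hp, k, K, ik, icp, ipf, iK, ialg, hfg, -, O, hO, -, R, hR, hRO, hfr, α, hdiv, hα⟩
    exact ⟨p, hp, k, K, ik, icp, ipf, iK, ialg, hfg, O, hO, R, hR, hRO, hfr, α, hdiv, hα⟩

end Summit.ResolutionOfSingularities.ResolutionOfSingularities.Theorems.WildSymbol.Birth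

end
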